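/-
COR-CM (cell pub-hodgecm2, stage 2 of the Hodge ladder) — count-neutral KERNEL COMBINATORICS «spectator doubling G = H × ⟨x⟩ (x a CENTRAL involution
outside the index-two subgroup H ∋ c), part II: the spectator checklist on block representatives and the count
μ(H × C₂, c) ≤ μ(H, c) + #{blocks of distance ≥ 2} + (|H|/2) · #{blocks of distance 1}» (seat prover-pub-hodgecm2-b23-g47-0, binder prover b23,
gen 47; claim «SPECTATOR DOUBLING», HOME/INBOX.md l.21993).  Theorems only, on top of part I `Census/SpectatorSquares` and gen 46ʼs
`Census/IndexTwoSplitOrbits` (checklist on block representatives) BY NAME; no `decide`, no certificate, no named fact, no `sorry`; `Interfaces.lean`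
(C1), every E term, B01, `Transposition/*`, `PortJoin/*`, `D2Bridge/*` untouched.
HONEST FRAMING: `HC_CM` is NOT proved, here or anywhere in the tree; nothing here is a period, a count of record or a headline.
T5: n/a-class (hypothesis binders: `c * c = 1`, `c ≠ 1`, `c` central, `c ∈ H`, `H.index = 2`, `x ∉ H`, `x * x = 1`, `x` central); checker: self.
-/
import Summits.HodgeConjecture.CorCM.Census.SpectatorSquares

/-!
# Spectator doubling `G = H × ⟨x⟩`, II: the checklist on block representatives and `μ(H × C₂) ≤ μ(H) + B_{≥2} + n_H · B₁`

THE SETTING of part I (`Census/SpectatorSquares.lean`): `c ≠ 1` a central involution of the finite group `G`, `H ∋ c` of index two, `x ∉ H`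
with `x · x = 1` and `x` CENTRAL (`G = H × ⟨x⟩`; the Galois CM field is a compositum `F₀ · k` with a disjoint real quadratic field `k`).
`D(Ψ) = wt (res₁ Ψ) (res₀ Ψ)` is the distance of a type; blocks are DIAGONAL (`D = 0`), NEIGHBOUR (`D = 1`) or FAR (`D ≥ 2`).

* §4 From block representatives to all types: neighbour types stay neighbour types under base change (`exists_nbr_rt`), so the parallel faces
  `gface (rep b) m (x·m)` at ONE type per neighbour block give all parallel faces at all neighbour types (`parallel_mem_of_reps`); a mixed face at
  two distinct deviations at ONE type per far block gives one at every far type (`exists_dev_face_of_reps`, pull-backs along `h ∈ H` and along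
  the swap `x`).  **THE SPECTATOR CHECKLIST** (`hodgeSpan_le_of_spectator_reps`): a base-change-stable `N ≤ hodgeSpan` containing the pairs, a
  lift of every member of an `H`-generating family, one distance-lowering mixed face at every far representative and the parallel faces at every
  neighbour representative IS the whole Hodge lattice — by part I no two-cycle and no square obligation is left.
* §5 **THE COUNT** (`exists_generating_family_spectator`, `exists_generating_family_spectator_card`, `sInf_le_spectator`):
  **`μ(G, c) ≤ |S| + #{far blocks} + (|H|/2) · #{neighbour blocks}`** for every `H`-generating face family `S` (the parallel faces at a neighbour
  representative `Ψ_b` are the `|H|/2` faces `gface Ψ_b m (x·m)`, `m ∈ res₀ Ψ_b`, one per place of `H`).  Numerically (design note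
  `HOME/pub-hodgecm2-b23/SPECTATOR.md`) the sharp value is `μ(H) + #{far} + #{neighbour} = φ₂(G, c)` in every case computed
  (`H = ℤ/4, ℤ/2², ℤ/6, ℤ/8, ℤ/4 × ℤ/2, D₄, Q₈` and gen 46ʼs eight order-`32` spectator rows), i.e. ONE parallel face per neighbour block would do;
  the uniform bound here spends `|H|/2` of them.  The floor `μ(G, c) ≥ φ₂(G, c) = β(G, c) − 2 + d₂(H)` is part III.

## References
* [Pohlmann1968] H. Pohlmann, Algebraic cycles on abelian varieties of complex multiplication type, Ann. of Math. 88 (1968), Thm 1.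
-/

namespace Summit.HodgeConjecture.CorCM.Census.Spectator

open Finset
open Summit.HodgeConjecture.CorCM.Prior.AllgGroup.RfwfAllgGroup
open Summit.HodgeConjecture.CorCM.Census.BlockParity
open Summit.HodgeConjecture.CorCM.Census.Coinvariant
open Summit.HodgeConjecture.CorCM.Census.ComplementFaces
open Summit.HodgeConjecture.CorCM.Census.IndexTwoDescent

noncomputable section

variable {G : Type*} [Group G] [Fintype G] [DecidableEq G] {c : G}
variable {H : Subgroup G} [DecidablePred (· ∈ H)]

/-! ## §4 From block representatives to all types -/

/-- **Neighbour types stay neighbour types under base change** (spectator case): if `res₁ Θ = (res₀ Θ)^{(t)}` then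
`res₁ (Θ·Q⁻¹) = (res₀ (Θ·Q⁻¹))^{(t')}` for some `t'`. [folklore] -/
theorem exists_nbr_rt (hcH : c ∈ H) (hcen : ∀ g : G, g * c = c * g) (hc2 : c * c = 1) (hH : H.index = 2) {x : G} (hx : x ∉ H)
    (hxx : x * x = 1) (hxc : ∀ g : G, g * x = x * g) (Q : G) {Θ : CMF G c} {t : H}
    (hΘ : res₁ hcH hcen x Θ = oflipCM (⟨c, hcH⟩ : H) (csub_mul_csub hcH hc2) t (res₀ hcH Θ)) :
    ∃ t' : H, res₁ hcH hcen x (rt c Q Θ) = oflipCM (⟨c, hcH⟩ : H) (csub_mul_csub hcH hc2) t' (res₀ hcH (rt c Q Θ)) := by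
  have hc2' := csub_mul_csub hcH hc2
  by_cases hQ : Q ∈ H
  · obtain ⟨q, rfl⟩ : ∃ q : H, (q : G) = Q := ⟨⟨Q, hQ⟩, rfl⟩
    refine ⟨t * q⁻¹, ?_⟩
    rw [res₁_rt_coe, res₀_rt_coe, hΘ, rt_oflipCM _ hc2']
  · obtain ⟨q, rfl⟩ := exists_eq_mul_of_not_mem hH hx hQ
    refine ⟨t * q⁻¹, ?_⟩
    rw [rt_mul, res₁_rt_x hcH hcen hxx hxc, res₀_rt_x hcH hcen hxc, res₁_rt_coe, res₀_rt_coe, hΘ, rt_oflipCM _ hc2',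
      oflipCM_oflipCM_self]

/-- **Parallel faces: from neighbour-block representatives to every neighbour type** (spectator case): if a base-change-stable `N` contains
the parallel faces `gface (rep b) m (x·m)`, `m ∈ H`, at a representative of every neighbour block, it contains every parallel face at every
neighbour type. [folklore] -/
theorem parallel_mem_of_reps (hcH : c ∈ H) (hcen : ∀ g : G, g * c = c * g) (hc2 : c * c = 1) (hH : H.index = 2) {x : G} (hx : x ∉ H)
    (hxx : x * x = 1) (hxc : ∀ g : G, g * x = x * g)
    (N : Submodule ℤ (CMF G c →₀ ℤ)) (hN : ∀ Q : G, ∀ y ∈ N, Finsupp.mapDomain (rt c Q) y ∈ N)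
    (rep : Block c → CMF G c) (hrep : ∀ b : Block c, blk c (rep b) = b)
    (hparrep : ∀ b : Block c, (∃ t : H, res₁ hcH hcen x (rep b) = oflipCM (⟨c, hcH⟩ : H) (csub_mul_csub hcH hc2) t (res₀ hcH (rep b))) →
      ∀ m : H, gface c hc2 (rep b) (m : G) (x * (m : G)) ∈ N)
    (Θ : CMF G c) (t : H) (hΘ : res₁ hcH hcen x Θ = oflipCM (⟨c, hcH⟩ : H) (csub_mul_csub hcH hc2) t (res₀ hcH Θ)) (m : H) :
    gface c hc2 Θ (m : G) (x * (m : G)) ∈ N := by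
  obtain ⟨Q, hQ⟩ := exists_rt_eq_of_blk_eq c (show blk c Θ = blk c (rep (blk c Θ)) by rw [hrep])
  obtain ⟨t', ht'⟩ := exists_nbr_rt hcH hcen hc2 hH hx hxx hxc Q hΘ
  obtain ⟨m', hm'⟩ := exists_twoCycle_mem_iff_of_rt hc2 hH hx hxx N hN Q Θ m
  rw [hm', hQ]
  exact hparrep _ ⟨t', by rw [← hQ]; exact ht'⟩ m'

/-- Pull-back of a distance-lowering mixed face along `h ∈ H`: if `Ψ·h⁻¹` carries a mixed face at two distinct deviations in the base-change-stable
`N`, so does `Ψ`. [folklore] -/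
theorem exists_dev_face_of_rt_coe (hcH : c ∈ H) (hcen : ∀ g : G, g * c = c * g) (hc2 : c * c = 1) (x : G)
    (N : Submodule ℤ (CMF G c →₀ ℤ)) (hN : ∀ Q : G, ∀ y ∈ N, Finsupp.mapDomain (rt c Q) y ∈ N) (Ψ : CMF G c) (h : H)
    (hex : ∃ d d' : H, d ∈ (res₁ hcH hcen x (rt c (h : G) Ψ)).1 ∧ d ∉ (res₀ hcH (rt c (h : G) Ψ)).1 ∧
      d' ∈ (res₁ hcH hcen x (rt c (h : G) Ψ)).1 ∧ d' ∉ (res₀ hcH (rt c (h : G) Ψ)).1 ∧ d ≠ d' ∧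
      gface c hc2 (rt c (h : G) Ψ) (d : G) (x * (d' : G)) ∈ N) :
    ∃ d d' : H, d ∈ (res₁ hcH hcen x Ψ).1 ∧ d ∉ (res₀ hcH Ψ).1 ∧ d' ∈ (res₁ hcH hcen x Ψ).1 ∧ d' ∉ (res₀ hcH Ψ).1 ∧ d ≠ d' ∧
      gface c hc2 Ψ (d : G) (x * (d' : G)) ∈ N := by
  obtain ⟨d, d', hd1, hd0, hd'1, hd'0, hne, hmem⟩ := hex
  have hpull := hN ((h : G))⁻¹ _ hmem
  have e : ((h : G))⁻¹ = ((h⁻¹ : H) : G) := rfl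
  rw [e, mapDomain_rt_coe_mixed, ← e, rt_inv_rt, inv_inv] at hpull
  have dk := dev_rt_coe hcH hcen x Ψ (d * h) h
  have dl := dev_rt_coe hcH hcen x Ψ (d' * h) h
  simp only [mul_inv_cancel_right] at dk dl
  exact ⟨d * h, d' * h, dk.1.mp hd1, fun h' => hd0 (dk.2.mpr h'), dl.1.mp hd'1, fun h' => hd'0 (dl.2.mpr h'),
    fun h' => hne (mul_right_cancel h'), hpull⟩

/-- Pull-back of a distance-lowering mixed face along the spectator `x`: if `Ψ·x` carries a mixed face at two distinct deviations in the
base-change-stable `N`, so does `Ψ` (the deviations move to the other elements of their places). [folklore] -/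
theorem exists_dev_face_of_rt_x (hcH : c ∈ H) (hcen : ∀ g : G, g * c = c * g) (hc2 : c * c = 1) {x : G}
    (hxx : x * x = 1) (hxc : ∀ g : G, g * x = x * g)
    (N : Submodule ℤ (CMF G c →₀ ℤ)) (hN : ∀ Q : G, ∀ y ∈ N, Finsupp.mapDomain (rt c Q) y ∈ N) (Ψ : CMF G c)
    (hex : ∃ d d' : H, d ∈ (res₁ hcH hcen x (rt c x Ψ)).1 ∧ d ∉ (res₀ hcH (rt c x Ψ)).1 ∧
      d' ∈ (res₁ hcH hcen x (rt c x Ψ)).1 ∧ d' ∉ (res₀ hcH (rt c x Ψ)).1 ∧ d ≠ d' ∧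
      gface c hc2 (rt c x Ψ) (d : G) (x * (d' : G)) ∈ N) :
    ∃ d d' : H, d ∈ (res₁ hcH hcen x Ψ).1 ∧ d ∉ (res₀ hcH Ψ).1 ∧ d' ∈ (res₁ hcH hcen x Ψ).1 ∧ d' ∉ (res₀ hcH Ψ).1 ∧ d ≠ d' ∧
      gface c hc2 Ψ (d : G) (x * (d' : G)) ∈ N := by
  set c₁ : H := ⟨c, hcH⟩ with hc₁
  obtain ⟨d, d', hd1, hd0, hd'1, hd'0, hne, hmem⟩ := hex
  rw [res₁_rt_x hcH hcen hxx hxc] at hd1 hd'1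
  rw [res₀_rt_x hcH hcen hxc] at hd0 hd'0
  have hpull := hN x _ hmem
  rw [mapDomain_rt_x_mixed hc2 hxx hxc, ← rt_mul, hxx, rt_one] at hpull
  -- `gface Ψ d' (x d) = gface Ψ (c d') (x (c d))`, and `c d'`, `c d` are deviations of `Ψ`
  have e : gface c hc2 Ψ ((c₁ * d' : H) : G) (x * ((c₁ * d : H) : G)) = gface c hc2 Ψ (d' : G) (x * (d : G)) :=
    gface_eq_of_orb hcen hc2 x Ψ (Or.inr rfl) (Or.inr rfl)
  refine ⟨c₁ * d', c₁ * d, ?_, ?_, ?_, ?_, ?_, by rw [e]; exact hpull⟩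
  · by_contra h'; exact hd'0 (((res₁ hcH hcen x Ψ).2 d').mpr h')
  · exact ((res₀ hcH Ψ).2 d').mp hd'1
  · by_contra h'; exact hd0 (((res₁ hcH hcen x Ψ).2 d).mpr h')
  · exact ((res₀ hcH Ψ).2 d).mp hd1
  · exact fun h' => hne (mul_left_cancel h').symm

/-- **Distance-lowering faces: from far-block representatives to every far type** (spectator case): if a base-change-stable `N` contains at a
representative of every block of distance `≥ 2` a mixed face at two distinct deviations, it contains such a face at every type of distance `≥ 2`.
[folklore] -/
theorem exists_dev_face_of_reps (hcH : c ∈ H) (hcen : ∀ g : G, g * c = c * g) (hc2 : c * c = 1) (hH : H.index = 2) {x : G} (hx : x ∉ H)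
    (hxx : x * x = 1) (hxc : ∀ g : G, g * x = x * g)
    (N : Submodule ℤ (CMF G c →₀ ℤ)) (hN : ∀ Q : G, ∀ y ∈ N, Finsupp.mapDomain (rt c Q) y ∈ N)
    (rep : Block c → CMF G c) (hrep : ∀ b : Block c, blk c (rep b) = b)
    (hdesc : ∀ b : Block c, 2 ≤ wt (⟨c, hcH⟩ : H) (res₁ hcH hcen x (rep b)) (res₀ hcH (rep b)) → ∃ d d' : H,
      d ∈ (res₁ hcH hcen x (rep b)).1 ∧ d ∉ (res₀ hcH (rep b)).1 ∧ d' ∈ (res₁ hcH hcen x (rep b)).1 ∧ d' ∉ (res₀ hcH (rep b)).1 ∧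
      d ≠ d' ∧ gface c hc2 (rep b) (d : G) (x * (d' : G)) ∈ N)
    (Ψ : CMF G c) (h2 : 2 ≤ wt (⟨c, hcH⟩ : H) (res₁ hcH hcen x Ψ) (res₀ hcH Ψ)) :
    ∃ d d' : H, d ∈ (res₁ hcH hcen x Ψ).1 ∧ d ∉ (res₀ hcH Ψ).1 ∧ d' ∈ (res₁ hcH hcen x Ψ).1 ∧ d' ∉ (res₀ hcH Ψ).1 ∧ d ≠ d' ∧
      gface c hc2 Ψ (d : G) (x * (d' : G)) ∈ N := by
  obtain ⟨Q, hQ⟩ := exists_rt_eq_of_blk_eq c (show blk c Ψ = blk c (rep (blk c Ψ)) by rw [hrep])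
  have h2' : 2 ≤ wt (⟨c, hcH⟩ : H) (res₁ hcH hcen x (rep (blk c Ψ))) (res₀ hcH (rep (blk c Ψ))) := by
    rw [← hQ, wt_res_rt hcH hcen hc2 hH hx hxx]; exact h2
  have hex := hdesc _ h2'
  rw [← hQ] at hex
  by_cases hQH : Q ∈ H
  · obtain ⟨q, rfl⟩ : ∃ q : H, (q : G) = Q := ⟨⟨Q, hQH⟩, rfl⟩
    exact exists_dev_face_of_rt_coe hcH hcen hc2 x N hN Ψ q hex
  · obtain ⟨q, rfl⟩ := exists_eq_mul_of_not_mem hH hx hQH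
    rw [rt_mul] at hex
    exact exists_dev_face_of_rt_coe hcH hcen hc2 x N hN Ψ q (exists_dev_face_of_rt_x hcH hcen hc2 hxx hxc N hN _ hex)

/-- **THE SPECTATOR CHECKLIST** (`x` central, `x·x = 1`).  Let `rep : Block c → CMF G c` pick one type per block.  A base-change-stable
`N ≤ hodgeSpan (G, c)` containing the pairs IS the whole Hodge lattice as soon as it holds (1) a lift of every member of an `H`-generating family
`S`; (2) at every representative of distance `≥ 2` one mixed face at two distinct deviations; (3) at every representative of distance `1` the
parallel faces `gface (rep b) m (x·m)`, `m ∈ H`.  No two-cycle and no square obligation is left. [folklore] -/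
theorem hodgeSpan_le_of_spectator_reps (hcH : c ∈ H) (hc2 : c * c = 1) (hc1 : c ≠ 1) (hcen : ∀ g : G, g * c = c * g) (hH : H.index = 2)
    {x : G} (hx : x ∉ H) (hxx : x * x = 1) (hxc : ∀ g : G, g * x = x * g) (S : Finset (CMF H ⟨c, hcH⟩ →₀ ℤ))
    (hS : hodgeSpan (⟨c, hcH⟩ : H) (csub_mul_csub hcH hc2) ≤
      Submodule.span ℤ (pairSet (⟨c, hcH⟩ : H)) ⊔ Submodule.span ℤ (translates (⟨c, hcH⟩ : H) S))
    (N : Submodule ℤ (CMF G c →₀ ℤ)) (hNH : N ≤ hodgeSpan c hc2) (hN : ∀ Q : G, ∀ y ∈ N, Finsupp.mapDomain (rt c Q) y ∈ N)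
    (hP : Submodule.span ℤ (pairSet c) ≤ N)
    (hlift : ∀ f ∈ S, ∃ F ∈ N, marg₀ hcH F = f ∧ marg₁ hcH hcen x F = 0)
    (rep : Block c → CMF G c) (hrep : ∀ b : Block c, blk c (rep b) = b)
    (hdesc : ∀ b : Block c, 2 ≤ wt (⟨c, hcH⟩ : H) (res₁ hcH hcen x (rep b)) (res₀ hcH (rep b)) → ∃ d d' : H,
      d ∈ (res₁ hcH hcen x (rep b)).1 ∧ d ∉ (res₀ hcH (rep b)).1 ∧ d' ∈ (res₁ hcH hcen x (rep b)).1 ∧ d' ∉ (res₀ hcH (rep b)).1 ∧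
      d ≠ d' ∧ gface c hc2 (rep b) (d : G) (x * (d' : G)) ∈ N)
    (hparrep : ∀ b : Block c, (∃ t : H, res₁ hcH hcen x (rep b) = oflipCM (⟨c, hcH⟩ : H) (csub_mul_csub hcH hc2) t (res₀ hcH (rep b))) →
      ∀ m : H, gface c hc2 (rep b) (m : G) (x * (m : G)) ∈ N) :
    hodgeSpan c hc2 ≤ N := by
  have hpar := parallel_mem_of_reps hcH hcen hc2 hH hx hxx hxc N hN rep hrep hparrep
  have hdev := exists_dev_face_of_reps hcH hcen hc2 hH hx hxx hxc N hN rep hrep hdesc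
  refine hodgeSpan_le_of_rep_checklist hcH hc2 hc1 hcen hH hx hxx S hS N hNH hN hP hlift rep hrep ?_ ?_ ?_
  · intro b h2
    obtain ⟨d, d', hd1, hd0, hd'1, hd'0, hne, hmem⟩ := hdesc b h2
    obtain ⟨e1, e2, e3⟩ := descends_of_devs hcH hcen hc2 hx (rep b) hd1 hd0 hd'1 hd'0 hne
    exact ⟨d, d', hmem, by omega, by omega, by omega⟩
  · intro b hb t
    exact twoCycle_mem_of_parallel hcH hcen hc2 hx N hpar (rep b) hb t
  · intro b h2 k l hk1 hk0 hl1 hl0 hkl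
    exact square_mem_of_parallel hcH hcen hc2 hH hx hxx hxc N hN hpar (fun Ψ hΨ => hdev Ψ (le_of_eq hΨ.symm)) (rep b) h2 k l
      hk1 hk0 hl1 hl0 hkl

/-! ## §5 The count: `μ(G, c) ≤ |S| + #{far blocks} + n_H · #{neighbour blocks}` -/

/-- **THE SPECTATOR GENERATING FAMILY.**  For `x` central with `x·x = 1` outside the index-two subgroup `H ∋ c` and every family `S` of faces
of `(H, c)` whose base changes generate `hodgeSpan (H, c)` modulo pairs, the Hodge lattice of `(G, c)` is generated modulo pairs by the base
changes of: the lifts of `S` (`≤ |S|` faces), ONE distance-lowering mixed face per block of distance `≥ 2`, and the parallel faces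
`gface Ψ_b m (x·m)`, `m ∈ res₀ Ψ_b` (one per place of `H`), at one type `Ψ_b` of every block of distance `1` —
**`μ(G, c) ≤ |S| + #{blocks of distance ≥ 2} + Σ_{blocks of distance 1} |H|/2`**. [folklore] -/
theorem exists_generating_family_spectator (hcH : c ∈ H) (hc2 : c * c = 1) (hc1 : c ≠ 1) (hcen : ∀ g : G, g * c = c * g)
    (hH : H.index = 2) {x : G} (hx : x ∉ H) (hxx : x * x = 1) (hxc : ∀ g : G, g * x = x * g) (S : Finset (CMF H ⟨c, hcH⟩ →₀ ℤ))
    (hSf : (S : Set (CMF H ⟨c, hcH⟩ →₀ ℤ)) ⊆ gfaceSet H ⟨c, hcH⟩ (csub_mul_csub hcH hc2))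
    (hS : hodgeSpan (⟨c, hcH⟩ : H) (csub_mul_csub hcH hc2) ≤
      Submodule.span ℤ (pairSet (⟨c, hcH⟩ : H)) ⊔ Submodule.span ℤ (translates (⟨c, hcH⟩ : H) S)) :
    ∃ 𝒮 : Finset (CMF G c →₀ ℤ), (𝒮 : Set (CMF G c →₀ ℤ)) ⊆ gfaceSet G c hc2 ∧
      𝒮.card ≤ S.card +
        (Finset.univ.filter fun b : Block c => 2 ≤ wt (⟨c, hcH⟩ : H) (res₁ hcH hcen x b.out) (res₀ hcH b.out)).card +
        ∑ b ∈ Finset.univ.filter (fun b : Block c => wt (⟨c, hcH⟩ : H) (res₁ hcH hcen x b.out) (res₀ hcH b.out) = 1),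
          (res₀ hcH b.out).1.card ∧
      hodgeSpan c hc2 ≤ Submodule.span ℤ (pairSet c) ⊔ Submodule.span ℤ (translates c 𝒮) := by
  classical
  have hc2' := csub_mul_csub hcH hc2
  -- (1) lifts
  let L : (CMF H ⟨c, hcH⟩ →₀ ℤ) → (CMF G c →₀ ℤ) := fun f =>
    if hf : f ∈ gfaceSet H ⟨c, hcH⟩ hc2' then
      gface c hc2 (glue hcH hcen hH hx hf.choose hf.choose) (hf.choose_spec.choose : G) (hf.choose_spec.choose_spec.choose : G)
    else 0
  have hL : ∀ f, (hf : f ∈ gfaceSet H ⟨c, hcH⟩ hc2') →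
      L f ∈ gfaceSet G c hc2 ∧ marg₀ hcH (L f) = f ∧ marg₁ hcH hcen x (L f) = 0 := by
    intro f hf
    have hspec := hf.choose_spec.choose_spec.choose_spec
    simp only [L, dif_pos hf]
    refine ⟨gface_glue_mem_gfaceSet hcH hcen hc2 hH hx _ hspec.1, ?_, marg₁_gface_coe_coe hcH hcen hc2 hx _ _ _⟩
    rw [marg₀_gface_glue, ← hspec.2]
  -- (2) one distance-lowering mixed face per far block
  let f : Block c → (CMF G c →₀ ℤ) := fun b =>
    if h : 2 ≤ wt (⟨c, hcH⟩ : H) (res₁ hcH hcen x b.out) (res₀ hcH b.out) then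
      gface c hc2 b.out ((exists_descending_mixed hcH hcen hc2 hx b.out h).choose : G)
        (x * ((exists_descending_mixed hcH hcen hc2 hx b.out h).choose_spec.choose : G))
    else 0
  let 𝒟 : Finset (CMF G c →₀ ℤ) := (Finset.univ.filter fun b : Block c => 2 ≤ wt (⟨c, hcH⟩ : H) (res₁ hcH hcen x b.out) (res₀ hcH b.out)).image f
  -- (3) the parallel faces at one type of every neighbour block
  let par : Block c → Finset (CMF G c →₀ ℤ) := fun b =>
    (res₀ hcH b.out).1.image fun m : H => gface c hc2 b.out (m : G) (x * (m : G))
  let Pf : Finset (CMF G c →₀ ℤ) := (Finset.univ.filter fun b : Block c => wt (⟨c, hcH⟩ : H) (res₁ hcH hcen x b.out) (res₀ hcH b.out) = 1).biUnion par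
  have h𝒟f : (𝒟 : Set (CMF G c →₀ ℤ)) ⊆ gfaceSet G c hc2 := by
    intro y hy
    obtain ⟨b, hb, rfl⟩ := Finset.mem_image.mp (Finset.mem_coe.mp hy)
    have h2 : 2 ≤ wt (⟨c, hcH⟩ : H) (res₁ hcH hcen x b.out) (res₀ hcH b.out) := (Finset.mem_filter.mp hb).2
    simp only [f, dif_pos h2]
    exact mixedSet_subset_gfaceSet hcH hc2 hx ⟨_, _, _, rfl⟩
  have hPff : (Pf : Set (CMF G c →₀ ℤ)) ⊆ gfaceSet G c hc2 := by
    intro y hy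
    obtain ⟨b, -, hyb⟩ := Finset.mem_biUnion.mp (Finset.mem_coe.mp hy)
    obtain ⟨m, -, rfl⟩ := Finset.mem_image.mp hyb
    exact mixedSet_subset_gfaceSet hcH hc2 hx ⟨_, _, _, rfl⟩
  refine ⟨S.image L ∪ 𝒟 ∪ Pf, ?_, ?_, ?_⟩
  · intro y hy
    rcases Finset.mem_union.mp (Finset.mem_coe.mp hy) with hy | hy
    · rcases Finset.mem_union.mp hy with hy | hy
      · obtain ⟨g, hg, rfl⟩ := Finset.mem_image.mp hy
        exact (hL g (hSf (Finset.mem_coe.mpr hg))).1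
      · exact h𝒟f (Finset.mem_coe.mpr hy)
    · exact hPff (Finset.mem_coe.mpr hy)
  · -- the count
    have h1 : (S.image L).card ≤ S.card := Finset.card_image_le
    have h2 : 𝒟.card ≤ (Finset.univ.filter fun b : Block c => 2 ≤ wt (⟨c, hcH⟩ : H) (res₁ hcH hcen x b.out) (res₀ hcH b.out)).card := Finset.card_image_le
    have h3 : Pf.card ≤ ∑ b ∈ Finset.univ.filter (fun b : Block c => wt (⟨c, hcH⟩ : H) (res₁ hcH hcen x b.out) (res₀ hcH b.out) = 1), (res₀ hcH b.out).1.card :=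
      le_trans Finset.card_biUnion_le (Finset.sum_le_sum fun b _ => Finset.card_image_le)
    exact le_trans (Finset.card_union_le _ _) (by
      have := Finset.card_union_le (S.image L) 𝒟
      omega)
  · -- generation, by the spectator checklist with `rep b = b.out`
    set N := Submodule.span ℤ (pairSet c) ⊔ Submodule.span ℤ (translates c (S.image L ∪ 𝒟 ∪ Pf)) with hN
    have h𝒮f : ((S.image L ∪ 𝒟 ∪ Pf : Finset _) : Set (CMF G c →₀ ℤ)) ⊆ gfaceSet G c hc2 := by
      intro y hy
      rcases Finset.mem_union.mp (Finset.mem_coe.mp hy) with hy | hy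
      · rcases Finset.mem_union.mp hy with hy | hy
        · obtain ⟨g, hg, rfl⟩ := Finset.mem_image.mp hy
          exact (hL g (hSf (Finset.mem_coe.mpr hg))).1
        · exact h𝒟f (Finset.mem_coe.mpr hy)
      · exact hPff (Finset.mem_coe.mpr hy)
    have hNH : N ≤ hodgeSpan c hc2 := sup_le le_sup_right (span_translates_le_hodgeSpan hc2 _ h𝒮f)
    have hNrt : ∀ Q : G, ∀ y ∈ N, Finsupp.mapDomain (rt c Q) y ∈ N := fun Q y hy =>
      TwistGeneration.mapDomain_rt_mem_psp c hcen Q _ hy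
    have hmem : ∀ y ∈ S.image L ∪ 𝒟 ∪ Pf, y ∈ N := fun y hy =>
      Submodule.mem_sup_right (TwistGeneration.mem_span_translates_of_mem c _ hy)
    refine hodgeSpan_le_of_spectator_reps hcH hc2 hc1 hcen hH hx hxx hxc S hS N hNH hNrt le_sup_left ?_ (fun b => b.out)
      (fun b => Quotient.out_eq b) ?_ ?_
    · intro g hg
      have h := hL g (hSf (Finset.mem_coe.mpr hg))
      exact ⟨L g, hmem _ (Finset.mem_union_left _ (Finset.mem_union_left _ (Finset.mem_image_of_mem L hg))), h.2.1, h.2.2⟩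
    · intro b h2
      have hspec := (exists_descending_mixed hcH hcen hc2 hx b.out h2).choose_spec.choose_spec
      obtain ⟨hd1, hd0, hd'1, hd'0, hne, -, -, -⟩ := hspec
      refine ⟨_, _, hd1, hd0, hd'1, hd'0, hne, hmem _ (Finset.mem_union_left _ (Finset.mem_union_right _ ?_))⟩
      refine Finset.mem_image.mpr ⟨b, Finset.mem_filter.mpr ⟨Finset.mem_univ _, h2⟩, ?_⟩
      simp only [f, dif_pos h2]
    · rintro b ⟨t, ht⟩ m
      have hD : wt (⟨c, hcH⟩ : H) (res₁ hcH hcen x b.out) (res₀ hcH b.out) = 1 := by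
        rw [ht]; exact wt_oflipCM_eq_one (⟨c, hcH⟩ : H) hc2' _ t
      have hb : b ∈ Finset.univ.filter fun b : Block c => wt (⟨c, hcH⟩ : H) (res₁ hcH hcen x b.out) (res₀ hcH b.out) = 1 := Finset.mem_filter.mpr ⟨Finset.mem_univ _, hD⟩
      by_cases hm : m ∈ (res₀ hcH b.out).1
      · exact hmem _ (Finset.mem_union_right _ (Finset.mem_biUnion.mpr ⟨b, hb, Finset.mem_image.mpr ⟨m, hm, rfl⟩⟩))
      · have hcm : (⟨c, hcH⟩ : H) * m ∈ (res₀ hcH b.out).1 := by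
          by_contra h'; exact hm (((res₀ hcH b.out).2 m).mpr h')
        have e : gface c hc2 b.out (((⟨c, hcH⟩ : H) * m : H) : G) (x * (((⟨c, hcH⟩ : H) * m : H) : G)) = gface c hc2 b.out (m : G) (x * (m : G)) :=
          gface_eq_of_orb hcen hc2 x b.out (Or.inr rfl) (Or.inr rfl)
        rw [← e]
        exact hmem _ (Finset.mem_union_right _ (Finset.mem_biUnion.mpr ⟨b, hb, Finset.mem_image.mpr ⟨(⟨c, hcH⟩ : H) * m, hcm, rfl⟩⟩))

/-- A type of `(H, c)` has `|H|/2` elements, one per place. [folklore] -/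
theorem card_val_eq_half (hcH : c ∈ H) (hc2 : c * c = 1) (T : CMF H ⟨c, hcH⟩) : T.1.card = Fintype.card H / 2 := by
  have h := two_mul_card_val (⟨c, hcH⟩ : H) (csub_mul_csub hcH hc2) T
  omega

/-- **`μ(G, c) ≤ |S| + #{blocks of distance ≥ 2} + (|H|/2) · #{blocks of distance 1}`** for the spectator doubling `G = H × ⟨x⟩` and every
`H`-generating face family `S` (so `μ(H × C₂, c) ≤ μ(H, c) + #{far blocks} + n_H · #{neighbour blocks}`, `n_H = |H|/2` the number of places
of `H`). [folklore] -/
theorem exists_generating_family_spectator_card (hcH : c ∈ H) (hc2 : c * c = 1) (hc1 : c ≠ 1) (hcen : ∀ g : G, g * c = c * g)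
    (hH : H.index = 2) {x : G} (hx : x ∉ H) (hxx : x * x = 1) (hxc : ∀ g : G, g * x = x * g) (S : Finset (CMF H ⟨c, hcH⟩ →₀ ℤ))
    (hSf : (S : Set (CMF H ⟨c, hcH⟩ →₀ ℤ)) ⊆ gfaceSet H ⟨c, hcH⟩ (csub_mul_csub hcH hc2))
    (hS : hodgeSpan (⟨c, hcH⟩ : H) (csub_mul_csub hcH hc2) ≤
      Submodule.span ℤ (pairSet (⟨c, hcH⟩ : H)) ⊔ Submodule.span ℤ (translates (⟨c, hcH⟩ : H) S)) :
    ∃ 𝒮 : Finset (CMF G c →₀ ℤ), (𝒮 : Set (CMF G c →₀ ℤ)) ⊆ gfaceSet G c hc2 ∧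
      𝒮.card ≤ S.card +
        (Finset.univ.filter fun b : Block c => 2 ≤ wt (⟨c, hcH⟩ : H) (res₁ hcH hcen x b.out) (res₀ hcH b.out)).card +
        (Fintype.card H / 2) *
          (Finset.univ.filter fun b : Block c => wt (⟨c, hcH⟩ : H) (res₁ hcH hcen x b.out) (res₀ hcH b.out) = 1).card ∧
      hodgeSpan c hc2 ≤ Submodule.span ℤ (pairSet c) ⊔ Submodule.span ℤ (translates c 𝒮) := by
  obtain ⟨𝒮, h𝒮f, hcard, hgen⟩ := exists_generating_family_spectator hcH hc2 hc1 hcen hH hx hxx hxc S hSf hS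
  refine ⟨𝒮, h𝒮f, ?_, hgen⟩
  have hsum : ∑ b ∈ Finset.univ.filter (fun b : Block c => wt (⟨c, hcH⟩ : H) (res₁ hcH hcen x b.out) (res₀ hcH b.out) = 1),
      (res₀ hcH b.out).1.card =
      (Fintype.card H / 2) *
        (Finset.univ.filter fun b : Block c => wt (⟨c, hcH⟩ : H) (res₁ hcH hcen x b.out) (res₀ hcH b.out) = 1).card := by
    rw [Finset.sum_congr rfl fun b _ => card_val_eq_half hcH hc2 (res₀ hcH b.out), Finset.sum_const, smul_eq_mul, mul_comm]
  rw [hsum] at hcard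
  exact hcard

/-- **THE SPECTATOR UPPER BOUND in `sInf` form**: the census number `μ(G, c)` (least cardinality of a generating face family) is at most
`|S| + #{blocks of distance ≥ 2} + (|H|/2) · #{blocks of distance 1}` for every `H`-generating face family `S`. [folklore] -/
theorem sInf_le_spectator (hcH : c ∈ H) (hc2 : c * c = 1) (hc1 : c ≠ 1) (hcen : ∀ g : G, g * c = c * g)
    (hH : H.index = 2) {x : G} (hx : x ∉ H) (hxx : x * x = 1) (hxc : ∀ g : G, g * x = x * g) (S : Finset (CMF H ⟨c, hcH⟩ →₀ ℤ))
    (hSf : (S : Set (CMF H ⟨c, hcH⟩ →₀ ℤ)) ⊆ gfaceSet H ⟨c, hcH⟩ (csub_mul_csub hcH hc2))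
    (hS : hodgeSpan (⟨c, hcH⟩ : H) (csub_mul_csub hcH hc2) ≤
      Submodule.span ℤ (pairSet (⟨c, hcH⟩ : H)) ⊔ Submodule.span ℤ (translates (⟨c, hcH⟩ : H) S)) :
    sInf {n : ℕ | ∃ S' : Finset (CMF G c →₀ ℤ), (↑S' ⊆ gfaceSet G c hc2) ∧ S'.card = n ∧
      hodgeSpan c hc2 ≤ Submodule.span ℤ (pairSet c) ⊔ Submodule.span ℤ (translates c S')} ≤
      S.card + (Finset.univ.filter fun b : Block c => 2 ≤ wt (⟨c, hcH⟩ : H) (res₁ hcH hcen x b.out) (res₀ hcH b.out)).card +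
        (Fintype.card H / 2) *
          (Finset.univ.filter fun b : Block c => wt (⟨c, hcH⟩ : H) (res₁ hcH hcen x b.out) (res₀ hcH b.out) = 1).card := by
  obtain ⟨𝒮, h𝒮f, hcard, hgen⟩ := exists_generating_family_spectator_card hcH hc2 hc1 hcen hH hx hxx hxc S hSf hS
  exact le_trans (Nat.sInf_le ⟨𝒮, h𝒮f, rfl, hgen⟩) hcard

end

end Summit.HodgeConjecture.CorCM.Census.Spectator
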